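import Summits.HodgeConjecture.CorCM.GaloisTwoPowerDescentStructure
import HarnessLib

/-!
# THE DESCENT STEP of the `2`-power classification: an (H2)-violator survives in a structured CM quotient

COR-CM (cell `pub-hodgecm2`), binder seat b04 (gen 35), count-neutral own lane «Galois-CM-type classification».  KERNEL ONLY:
theorems; no definition, no named fact, no `sorry`.  `HC_CM` is neither used nor claimed.  A7-JUNCTION gen-34 §E, task (R2).

GOOD = every primitive CM type nondegenerate.  STRUCT(`K'`) = the conclusion of gen 34's (R1)
(`CorCM/GaloisTwoPowerOrderFourClassification`): `Gal(K'/ℚ) = H·E`, `H.IsComplement' E`, `E` central of exponent `2`, `|E| ≤ 2`,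
complex conjugation `c' ∈ H ∖ E`, `|H| = 2^k`, `H` cyclic or `≃ QuaternionGroup (2^(k-2))` — i.e. `Gal ∈ {C, Q, C × C₂, Q × C₂}`.
THEOREM: `K` Galois CM of degree `2^n`, `n ≥ 6`, GOOD, and STRUCT holds for every GOOD Galois CM field of degree `2^(n-1)`; then
(H2) holds for `K`: every `y` with `y⁴ = 1` has `y² ∈ {1, c}`.  Proof: if `t = y² ∉ {1, c}`, then `t` is a central involution
(gen 32), `N = ⟨t⟩`, and `K' = K^N` is GOOD (gen 32 monotonicity) of degree `2^(n-1)`, hence structured: `Gal(K'/ℚ) = H' × E'`.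
All involutions of a structured group are central (`CorCM/GaloisTwoPowerDescentStructure`), so `[y, G] ⊆ N`; the image `y'` of
`y` is an involution `∉ {1, c'}`, hence `∉ H'`, so `|H'| = 2^(n-2)`.
* `H'` CYCLIC `= ⟨g'⟩`, lift `g`: `a = g²` commutes with `y`, `orderOf a = 2^(n-3)` (`t ∉ ⟨g⟩`, else `⟨g⟩ ∋ t, c`), `⟨a⟩ ∩ ⟨y⟩ = 1`,
  `⟨a, y⟩` has index `2` and contains `c ∈ g^(2^(n-3)) N` — BAD by gen 34's `C_{2^m} × C₄` theorem
  (`CorCM/GaloisCyclicTimesFourIndexTwoDegenerate`, `m = n - 3 ≥ 3`).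
* `H'` QUATERNION with index-two data `a', x'`, lifts `a, x`: `x² ∈ {c, tc}`, `x a x⁻¹ ∈ {a⁻¹, t a⁻¹}`, `x y x⁻¹ ∈ {y, t y}`,
  `a y a⁻¹ ∈ {y, t y}`, `orderOf a = 2^(n-3)`.  If `a y a⁻¹ = t y`, the dicyclic-lift lemma gives `w` with `w² = tc` and
  `(a w)(w a)⁻¹ ∉ ⟨tc⟩` — impossible, since `K^⟨tc⟩` is structured too.  So `a y = y a`, and the same `C_{2^m} × C₄` kill applies with
  `⟨a, y⟩ ∋ c ∈ {a^(2^(n-4)), t a^(2^(n-4))}`.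
No size threshold beyond `2^n ≥ 64` (for gen 32's «involutions are central») is used, so the induction
(`CorCM/GaloisTwoPowerClassification`, same session) runs from degree `32`: STRUCT in degree `32` — the content of the seat's order-`32`
census — implies STRUCT, (H2) and the classification «GOOD ⟺ `C`, `Q`, `C × C₂`, `Q × C₂`» in every degree `2^n ≥ 32`.

* **`sq_eq_one_or_eq_complexConj_of_struct`** — the descent step.

## References

* [Shimura1998] G. Shimura, *Abelian Varieties with Complex Multiplication and Modular Functions*, §6.2 Thm. 3, §8.2 Prop. 26, §32.10.
* [Kubota1965] T. Kubota, *On the field extension by complex multiplication*, Trans. AMS 118 (1965), §2 and §4 Lemma 2.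
* [Rotman1995] J. J. Rotman, *An Introduction to the Theory of Groups*, 4th ed., GTM 148, Springer 1995, Thm. 5.46.
* [Gordon1999HodgeAVSurvey] B. B. Gordon, *A survey of the Hodge conjecture for abelian varieties*, Thm. 6.4, §9.3, §9.4.3.
-/

noncomputable section

open CategoryTheory CategoryTheory.Limits NumberField
open scoped BigOperators

namespace Summit.HodgeConjecture.CorCM.GaloisModels

open Literature.NumberTheory.ComplexMultiplication
open Literature.AlgebraicGeometry.Motives (AbelianVariety CMType)
open Literature.AlgebraicGeometry.HodgeTheory
open Literature.AlgebraicGeometry.Pohlmann1968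
open Summit.HodgeConjecture.CorCM.GaloisRank

section Field

variable {K : Type} [Field K] [NumberField K] [IsCMField K] [IsGalois ℚ K]

/-- **THE DESCENT STEP.**  `K` Galois CM of degree `2^n`, `n ≥ 6`, every primitive CM type nondegenerate (GOOD); suppose every
GOOD Galois CM field `K'` of degree `2^(n-1)` is structured (`Gal(K'/ℚ) = H·E`, `E` central of exponent `2`, `|E| ≤ 2`, `c' ∈ H ∖ E`,
`H` cyclic or generalised quaternion).  Then every `y ∈ Gal(K/ℚ)` with `y⁴ = 1` has `y² ∈ {1, c}` (`c` = complex conjugation).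
(Otherwise `K^⟨y²⟩` and `K^⟨c y²⟩` are structured GOOD Galois CM subfields of degree `2^(n-1)`; the cyclic case and the commuting
quaternion case give an index-two `C_{2^(n-3)} × C₄ ∋ c ≠ y²` — BAD; the non-commuting quaternion case gives an involution of
`Gal(K^⟨c y²⟩/ℚ)` that is not central — impossible in a structured group.) [cite: Shimura1998, §6.2 Thm. 3, §8.2 Prop. 26 and §32.10]
[cite: Kubota1965, §2 and §4 Lemma 2] [cite: Rotman1995, Thm. 5.46] [cite: Gordon1999HodgeAVSurvey, Thm. 6.4, §9.3 and §9.4.3] -/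
theorem sq_eq_one_or_eq_complexConj_of_struct {n : ℕ} (hdeg : Module.finrank ℚ K = 2 ^ n) (hn : 6 ≤ n)
    (hgood : ∀ (Φ : CMType K) (φ : K →+* ℂ), IsPrimitive (ℂ ≃+* ℂ) Φ.1 φ → IsNondegenerate Φ)
    (hS : ∀ (K' : Type) [Field K'] [NumberField K'] [IsCMField K'] [IsGalois ℚ K'],
      Module.finrank ℚ K' = 2 ^ (n - 1) →
      (∀ (Φ : CMType K') (φ : K' →+* ℂ), IsPrimitive (ℂ ≃+* ℂ) Φ.1 φ → IsNondegenerate Φ) →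
      ∃ (H E : Subgroup (K' ≃ₐ[ℚ] K')) (k : ℕ), H.IsComplement' E ∧ (IsCMField.complexConj K').restrictScalars ℚ ∈ H ∧
        (IsCMField.complexConj K').restrictScalars ℚ ∉ E ∧ (∀ e ∈ E, e * e = 1 ∧ ∀ g : K' ≃ₐ[ℚ] K', g * e = e * g) ∧
        Nat.card E ≤ 2 ∧ Nat.card H = 2 ^ k ∧ (IsCyclic H ∨ (3 ≤ k ∧ Nonempty (H ≃* QuaternionGroup (2 ^ (k - 2))))))
    (y : K ≃ₐ[ℚ] K) (hy4 : y ^ 4 = 1) : y * y = 1 ∨ y * y = (IsCMField.complexConj K).restrictScalars ℚ := by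
  classical
  by_contra hcon
  obtain ⟨hy2, hyc⟩ := not_or.1 hcon
  obtain ⟨m, rfl⟩ : ∃ m, n = m + 3 := ⟨n - 3, by omega⟩
  have hm3 : 3 ≤ m := by omega
  simp only [show m + 3 - 1 = m + 2 by omega] at hS
  set c := (IsCMField.complexConj K).restrictScalars ℚ with hc
  have hcc : c * c = 1 := model_complexConj_mul_self (MulEquiv.refl (K ≃ₐ[ℚ] K)) (by simp [hc])
  have hc1 : c ≠ 1 := model_complexConj_ne_one (MulEquiv.refl (K ≃ₐ[ℚ] K)) (by simp [hc])
  have hccen : ∀ g : K ≃ₐ[ℚ] K, g * c = c * g := fun g =>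
    (model_complexConj_comm (MulEquiv.refl (K ≃ₐ[ℚ] K)) (by simp [hc]) g).symm
  have hcard : Nat.card (K ≃ₐ[ℚ] K) = 2 ^ (m + 3) := by
    rw [Nat.card_eq_fintype_card, card_model_eq_finrank (MulEquiv.refl (K ≃ₐ[ℚ] K)), hdeg]
  have h8 : 8 ≤ 2 ^ m := le_trans (by norm_num) (Nat.pow_le_pow_right (by norm_num) hm3 : 2 ^ 3 ≤ 2 ^ m)
  have h52 : 52 ≤ Module.finrank ℚ K := by rw [hdeg, pow_add]; omega
  set t := y * y with ht
  have htt : t * t = 1 := by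
    rw [ht, show y * y * (y * y) = y ^ 4 by simp only [pow_succ, pow_zero, one_mul, mul_assoc]]
    exact hy4
  have ht1 : t ≠ 1 := hy2
  have htc : t ≠ c := hyc
  have htcen : ∀ g : K ≃ₐ[ℚ] K, g * t = t * g := fun g =>
    commute_of_involution_of_forall_isNondegenerate_of_le h52 hgood t htt g
  have hoy : orderOf y = 2 ^ 2 :=
    orderOf_eq_prime_pow (p := 2) (n := 1) (by rw [pow_one, pow_two]; exact hy2)
      (by rw [show 2 ^ (1 + 1) = 4 by norm_num]; exact hy4)
  have htcsq : t * c * (t * c) = 1 := by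
    calc t * c * (t * c) = t * (c * t) * c := by group
      _ = t * (t * c) * c := by rw [← hccen t]
      _ = (t * t) * (c * c) := by group
      _ = 1 := by rw [htt, hcc, one_mul]
  set N := Subgroup.zpowers t with hN
  have hmemN : ∀ σ : K ≃ₐ[ℚ] K, σ ∈ N ↔ σ = 1 ∨ σ = t := fun σ => by
    rw [hN]; exact mem_zpowers_iff_of_mul_self_eq_one htt σ
  have htN : t ∈ N := (hmemN t).2 (Or.inr rfl)
  haveI hNn : N.Normal := normal_zpowers_of_forall_comm htcen
  have hcN : c ∉ N := fun h => by
    rcases (hmemN c).1 h with h | h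
    · exact hc1 h
    · exact htc h.symm
  have hNbot : N ≠ ⊥ := fun h => ht1 (by
    have := htN
    rw [h] at this
    exact Subgroup.mem_bot.1 this)
  have hNidx : N.index = 2 ^ (m + 2) := by
    have h1 := index_zpowers_mul_two htt ht1
    rw [hcard, show 2 ^ (m + 3) = 2 ^ (m + 2) * 2 by rw [pow_succ]] at h1
    exact Nat.eq_of_mul_eq_mul_right (by norm_num) h1
  have hSN := fun (K' : Type) (i₁ : Field K') (i₂ : NumberField K') (i₃ : IsCMField K') (i₄ : IsGalois ℚ K')
    (hd : Module.finrank ℚ K' = N.index) => hS K' (hd.trans hNidx)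
  -- conjugates of `y`: the involution `y N` of the structured CM quotient `Gal/N` is central
  have hconj : ∀ g : K ≃ₐ[ℚ] K, g * y * g⁻¹ = y ∨ g * y * g⁻¹ = t * y := by
    intro g
    have h := mul_comm_mod_of_struct N hcN hNbot hgood hSN y g htN
    rcases (hmemN _).1 h with h | h
    · left
      rw [mul_inv_eq_one] at h
      rw [mul_inv_eq_iff_eq_mul, h]
    · right
      rw [mul_inv_eq_iff_eq_mul] at h
      rw [mul_inv_eq_iff_eq_mul, h]
      exact (mul_assoc t y g).symm
  set K' := IntermediateField.fixedField N with hK'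
  haveI : IsCMField K' := isCMField_fixedField_of_not_mem N hcN
  haveI : IsGalois ℚ K' := IsGalois.of_fixedField_normal_subgroup N
  set res := AlgEquiv.restrictNormalHom (F := ℚ) (K₁ := K) K' with hres
  have hsurj : Function.Surjective res := AlgEquiv.restrictNormalHom_surjective K
  have hkerN : res.ker = N :=
    (IntermediateField.restrictNormalHom_ker K').trans (IntermediateField.fixingSubgroup_fixedField N)
  have hker : ∀ σ : K ≃ₐ[ℚ] K, res σ = 1 ↔ σ ∈ N := by
    intro σ
    rw [← MonoidHom.mem_ker, hkerN]
  set c' := (IsCMField.complexConj K').restrictScalars ℚ with hc'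
  have hc'c' : c' * c' = 1 := model_complexConj_mul_self (MulEquiv.refl (K' ≃ₐ[ℚ] K')) (by simp [hc'])
  have hc'1 : c' ≠ 1 := model_complexConj_ne_one (MulEquiv.refl (K' ≃ₐ[ℚ] K')) (by simp [hc'])
  have hresc : res c = c' := by rw [hres, hc, hc']; exact restrictNormalHom_complexConj_of_tower K'
  have hgood' : ∀ (Φ : CMType K') (φ : K' →+* ℂ), IsPrimitive (ℂ ≃+* ℂ) Φ.1 φ → IsNondegenerate Φ :=
    fun Φ φ hprim => isNondegenerate_of_isPrimitive_of_fixedField_of_ne_bot N hcN hNbot hgood Φ φ hprim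
  have hdeg' : Module.finrank ℚ K' = 2 ^ (m + 2) := by rw [hK', finrank_fixedField_eq_index, hNidx]
  have hcardG' : Nat.card (K' ≃ₐ[ℚ] K') = 2 ^ (m + 2) := by
    rw [Nat.card_eq_fintype_card, card_model_eq_finrank (MulEquiv.refl (K' ≃ₐ[ℚ] K')), hdeg']
  obtain ⟨H', E', k, hHE, hcH, hcE, hE, hEcard, hHcard, hstruct⟩ := hS K' hdeg' hgood'
  -- the image `y' = res y` of `y` is an involution `∉ {1, c'}`, hence `∉ H'`: `|E'| = 2`, `|H'| = 2^(m+1)`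
  have hyN : y ∉ N := fun h => by
    rcases (hmemN y).1 h with h | h
    · exact ht1 (by rw [ht, h, mul_one])
    · exact ht1 (by rw [ht, h]; exact htt)
  have hy'sq : res y * res y = 1 := by rw [← map_mul, (hker _).2 htN]
  have hy'1 : res y ≠ 1 := fun h => hyN ((hker y).1 h)
  have hy'c : res y ≠ c' := by
    intro h
    have h1 : res (y * c) = 1 := by rw [map_mul, h, hresc]; exact hc'c'
    rcases (hmemN _).1 ((hker _).1 h1) with h2 | h2
    · have : y = c := by
        rw [mul_eq_one_iff_eq_inv] at h2
        rw [h2]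
        exact inv_eq_of_mul_eq_one_right hcc
      exact ht1 (by rw [ht, this, hcc])
    · have : y = t * c := by rw [← h2, mul_assoc, hcc, mul_one]
      exact ht1 (by rw [ht, this]; exact htcsq)
  have hkey : (∀ s ∈ H', s * s = 1 → s ≠ 1 → s = c') → res y ∉ H' ∧ k = m + 1 := by
    intro hinv
    have hyH : res y ∉ H' := fun h => hy'c (hinv _ h hy'sq hy'1)
    refine ⟨hyH, ?_⟩
    obtain ⟨⟨h, e⟩, hhe⟩ := hHE.2 (res y)
    change (h : K' ≃ₐ[ℚ] K') * e = res y at hhe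
    have he1 : (e : K' ≃ₐ[ℚ] K') ≠ 1 := by
      intro he
      apply hyH
      rw [← hhe, he, mul_one]
      exact h.2
    have hE2 : Nat.card E' = 2 := by
      refine le_antisymm hEcard ?_
      have hne : E' ≠ ⊥ := fun hb => he1 ((Subgroup.eq_bot_iff_forall E').1 hb _ e.2)
      exact (Subgroup.one_lt_card_iff_ne_bot E').2 hne
    have h1 := hHE.card_mul
    rw [hHcard, hE2, hcardG', show 2 ^ (m + 2) = 2 ^ (m + 1) * 2 by rw [pow_succ]] at h1
    exact Nat.pow_right_injective le_rfl (Nat.eq_of_mul_eq_mul_right (by norm_num) h1)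
  -- `⟨b⟩ ∩ ⟨y⟩ = 1` whenever `res b ∈ H'` and `t ∉ ⟨b⟩`
  have hint_of : res y ∉ H' → ∀ b : K ≃ₐ[ℚ] K, res b ∈ H' → t ∉ Subgroup.zpowers b →
      ∀ w : K ≃ₐ[ℚ] K, w ∈ Subgroup.zpowers b → w ∈ Subgroup.zpowers y → w = 1 := by
    intro hyH b hb htb w hwb hwy
    obtain ⟨j, rfl⟩ := Subgroup.mem_zpowers_iff.1 hwy
    have hw' : res (y ^ j) ∈ H' := by
      obtain ⟨i, hi⟩ := Subgroup.mem_zpowers_iff.1 hwb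
      rw [← hi, map_zpow]
      exact H'.zpow_mem hb i
    rcases zpow_eq_one_or_eq_of_mul_self_eq_one hy'sq j with h | h
    · have h1 : y ^ j ∈ N := (hker _).1 (by rw [map_zpow, h])
      rcases (hmemN _).1 h1 with h2 | h2
      · exact h2
      · exact absurd (h2 ▸ hwb) htb
    · rw [map_zpow, h] at hw'
      exact absurd hw' hyH
  have hmem_cN : ∀ s : K ≃ₐ[ℚ] K, res s = c' → c = s ∨ c = t * s := by
    intro s hs
    have h1 : res (c * s⁻¹) = 1 := by rw [map_mul, map_inv, hs, hresc, mul_inv_cancel]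
    rcases (hmemN _).1 ((hker _).1 h1) with h2 | h2
    · exact Or.inl (mul_inv_eq_one.1 h2)
    · exact Or.inr (mul_inv_eq_iff_eq_mul.1 h2)
  rcases hstruct with hcyc | ⟨hk3, ⟨f⟩⟩
  · /- CASE `H'` CYCLIC -/
    obtain ⟨gH, hgH⟩ := IsCyclic.exists_generator (α := H')
    have hogH : orderOf gH = 2 ^ k := by rw [orderOf_eq_card_of_forall_mem_zpowers hgH, hHcard]
    set g' : K' ≃ₐ[ℚ] K' := (gH : K' ≃ₐ[ℚ] K') with hg'
    have hog' : orderOf g' = 2 ^ k := by rw [hg', Subgroup.orderOf_coe, hogH]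
    have hmemH' : ∀ s : K' ≃ₐ[ℚ] K', s ∈ H' → s ∈ Subgroup.zpowers g' := by
      intro s hs
      obtain ⟨i, hi⟩ := Subgroup.mem_zpowers_iff.1 (hgH ⟨s, hs⟩)
      exact Subgroup.mem_zpowers_iff.2 ⟨i, by rw [hg', ← Subgroup.coe_zpow, hi]⟩
    have hinv : ∀ s ∈ H', s * s = 1 → s ≠ 1 → s = c' := fun s hs hss hs1 =>
      involution_eq_of_mem_zpowers hog' (hmemH' s hs) hss hs1 (hmemH' c' hcH) hc'c' hc'1
    obtain ⟨hyH, hk⟩ := hkey hinv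
    subst hk
    obtain ⟨g, hg⟩ := hsurj g'
    have hgH' : res g ∈ H' := by rw [hg]; exact gH.2
    -- `g y g⁻¹ ∈ {y, t y}` ⟹ `g²` commutes with `y`
    have hay : g ^ 2 * y = y * g ^ 2 := by
      rcases hconj g with h | h
      · rw [mul_inv_eq_iff_eq_mul] at h
        rw [pow_two, mul_assoc, h, ← mul_assoc, h, mul_assoc]
      · rw [mul_inv_eq_iff_eq_mul] at h
        calc g ^ 2 * y = g * (g * y) := by rw [pow_two, mul_assoc]
          _ = g * (t * y * g) := by rw [h]
          _ = t * (g * y) * g := by rw [show g * (t * y * g) = (g * t) * y * g by group, htcen g]; group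
          _ = t * (t * y * g) * g := by rw [h]
          _ = (t * t) * y * (g * g) := by group
          _ = y * g ^ 2 := by rw [htt, one_mul, pow_two]
    -- `orderOf g` is a power of `2`; `t ∉ ⟨g⟩` (else `⟨g⟩` contains the two involutions `t ≠ c`)
    obtain ⟨j, -, hj⟩ := (Nat.dvd_prime_pow Nat.prime_two).1 (hcard ▸ orderOf_dvd_natCard g)
    have htg : t ∉ Subgroup.zpowers g := by
      intro htg'
      obtain ⟨i, hi⟩ := Subgroup.mem_zpowers_iff.1 (hmemH' c' hcH)
      have hci := hmem_cN (g ^ i) (by rw [map_zpow, hg, hi])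
      have hcg : c ∈ Subgroup.zpowers g := by
        rcases hci with h | h
        · rw [h]; exact Subgroup.zpow_mem _ (Subgroup.mem_zpowers g) i
        · rw [h]; exact (Subgroup.zpowers g).mul_mem htg' (Subgroup.zpow_mem _ (Subgroup.mem_zpowers g) i)
      exact htc (involution_eq_of_mem_zpowers hj htg' htt ht1 hcg hcc hc1)
    -- `orderOf g = 2^(m+1)`, `orderOf (g²) = 2^m`
    have hgpow : g ^ 2 ^ (m + 1) = 1 := by
      have h1 : res (g ^ 2 ^ (m + 1)) = 1 := by rw [map_pow, hg, ← hog', pow_orderOf_eq_one]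
      rcases (hmemN _).1 ((hker _).1 h1) with h2 | h2
      · exact h2
      · exact absurd (h2 ▸ Subgroup.npow_mem_zpowers g _) htg
    have hgpow' : g ^ 2 ^ m ≠ 1 := by
      intro h
      have h1 : g' ^ 2 ^ m = 1 := by rw [← hg, ← map_pow, h, map_one]
      have h2 := orderOf_dvd_of_pow_eq_one h1
      rw [hog'] at h2
      have := (Nat.pow_dvd_pow_iff_le_right (by norm_num : 1 < 2)).1 h2
      omega
    have hog : orderOf g = 2 ^ (m + 1) := orderOf_eq_prime_pow hgpow' hgpow
    have hoa : orderOf (g ^ 2) = 2 ^ m := by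
      rw [orderOf_pow_of_dvd (by norm_num) (by rw [hog]; exact dvd_pow_self 2 (Nat.succ_ne_zero m)), hog, pow_succ,
        Nat.mul_div_cancel _ (by norm_num)]
    have hsub : Subgroup.zpowers (g ^ 2) ≤ Subgroup.zpowers g := Subgroup.zpowers_le.2 (Subgroup.npow_mem_zpowers g 2)
    have hg2H' : res (g ^ 2) ∈ H' := by rw [map_pow]; exact H'.pow_mem hgH' 2
    have hint : ∀ w : K ≃ₐ[ℚ] K, w ∈ Subgroup.zpowers (g ^ 2) → w ∈ Subgroup.zpowers y → w = 1 :=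
      hint_of hyH (g ^ 2) hg2H' (fun h => htg (hsub h))
    have hidx : (Subgroup.closure ({g ^ 2, y} : Set (K ≃ₐ[ℚ] K))).index = 2 :=
      index_closure_pair_eq_two hay hint (by rw [hcard, hoa, hoy]; ring)
    have hcA : c ∈ Subgroup.closure ({g ^ 2, y} : Set (K ≃ₐ[ℚ] K)) := by
      have hg2A : g ^ 2 ∈ Subgroup.closure ({g ^ 2, y} : Set (K ≃ₐ[ℚ] K)) := Subgroup.subset_closure (by simp)
      have hyA : y ∈ Subgroup.closure ({g ^ 2, y} : Set (K ≃ₐ[ℚ] K)) := Subgroup.subset_closure (by simp)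
      have htA : t ∈ Subgroup.closure ({g ^ 2, y} : Set (K ≃ₐ[ℚ] K)) := by rw [ht]; exact Subgroup.mul_mem _ hyA hyA
      have hc'pow : c' = g' ^ ((2 : ℤ) ^ (m + 1 - 1)) := (eq_halfpower_of_mem_zpowers hog' (hmemH' c' hcH) hc'c' hc'1).2
      rw [Nat.add_sub_cancel] at hc'pow
      have hgmA : g ^ ((2 : ℤ) ^ m) ∈ Subgroup.closure ({g ^ 2, y} : Set (K ≃ₐ[ℚ] K)) := by
        have h2 : ((2 : ℤ) ^ m) = ((2 : ℕ) : ℤ) * (2 : ℤ) ^ (m - 1) := by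
          push_cast
          rw [← pow_succ', Nat.sub_add_cancel (by omega : 1 ≤ m)]
        rw [h2, zpow_mul, zpow_natCast]
        exact Subgroup.zpow_mem _ hg2A _
      rcases hmem_cN (g ^ ((2 : ℤ) ^ m)) (by rw [map_zpow, hg, hc'pow]) with h2 | h2
      · rw [h2]; exact hgmA
      · rw [h2]; exact Subgroup.mul_mem _ htA hgmA
    have := complexConj_eq_sq_of_cyclic_times_four_index_two hgood (g ^ 2) y hay (by omega : 3 ≤ m) hoa hy4 hy2
      hint hidx hcA
    exact hyc this.symm
  · /- CASE `H'` GENERALISED QUATERNION -/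
    haveI : NeZero (2 ^ (k - 2)) := ⟨by positivity⟩
    obtain ⟨a', x', ha'H, hx'H, -, -, hx'a, hx'x, hinvol⟩ := exists_index_two_data_of_mulEquiv_quaternionGroup H' f
    have hc'pow : c' = a' ^ 2 ^ (k - 2) := hinvol c' hcH hc'c' hc'1
    have hinv : ∀ s ∈ H', s * s = 1 → s ≠ 1 → s = c' := fun s hs hss hs1 => by rw [hinvol s hs hss hs1, ← hc'pow]
    obtain ⟨hyH, hk⟩ := hkey hinv
    have he : k - 2 + 1 = m := by omega
    obtain ⟨a, ha⟩ := hsurj a'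
    obtain ⟨x, hx⟩ := hsurj x'
    have haH' : res a ∈ H' := by rw [ha]; exact ha'H
    -- `α = a^(2^(k-2)) ∈ {c, t c}`, `orderOf a = 2^m`, `a⁴ ≠ 1`, `t ∉ ⟨a⟩`
    have hα : c = a ^ 2 ^ (k - 2) ∨ c = t * a ^ 2 ^ (k - 2) := hmem_cN _ (by rw [map_pow, ha, hc'pow])
    have hαne : a ^ 2 ^ (k - 2) ≠ 1 := by
      rcases hα with h | h
      · rw [← h]; exact hc1
      · intro h'
        rw [h', mul_one] at h
        exact htc h.symm
    have hα2 : a ^ 2 ^ (k - 2 + 1) = 1 := by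
      rw [pow_succ, pow_mul, pow_two]
      rcases hα with h | h
      · rw [← h]; exact hcc
      · have h' : a ^ 2 ^ (k - 2) = t * c := by rw [h, ← mul_assoc, htt, one_mul]
        rw [h']; exact htcsq
    have hoa : orderOf a = 2 ^ m := by rw [← he]; exact orderOf_eq_prime_pow hαne hα2
    have ha4 : a ^ 4 ≠ 1 := by
      intro h
      have h1 := orderOf_dvd_of_pow_eq_one h
      rw [hoa, show (4 : ℕ) = 2 ^ 2 by norm_num] at h1
      have := (Nat.pow_dvd_pow_iff_le_right (by norm_num : 1 < 2)).1 h1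
      omega
    have hta : t ∉ Subgroup.zpowers a := by
      intro h
      have hαmem : a ^ 2 ^ (k - 2) ∈ Subgroup.zpowers a := Subgroup.npow_mem_zpowers a _
      have hαα : a ^ 2 ^ (k - 2) * a ^ 2 ^ (k - 2) = 1 := by rw [← pow_two, ← pow_mul, ← pow_succ, hα2]
      have := involution_eq_of_mem_zpowers hoa h htt ht1 hαmem hαα hαne
      rcases hα with h' | h'
      · exact htc (this.trans h'.symm)
      · rw [← this] at h'
        exact hc1 (h'.trans htt)
    have hint : ∀ w : K ≃ₐ[ℚ] K, w ∈ Subgroup.zpowers a → w ∈ Subgroup.zpowers y → w = 1 := hint_of hyH a haH' hta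
    have hxx : x * x = c ∨ x * x = t * c := by
      have h1 : res (c * (x * x)⁻¹) = 1 := by
        rw [map_mul, map_inv, map_mul, hx, hresc, hx'x, ← hc'pow, mul_inv_cancel]
      rcases (hmemN _).1 ((hker _).1 h1) with h2 | h2
      · exact Or.inl (mul_inv_eq_one.1 h2).symm
      · right
        rw [mul_inv_eq_iff_eq_mul] at h2
        rw [h2, ← mul_assoc, htt, one_mul]
    have hxa : x * a * x⁻¹ = a⁻¹ ∨ x * a * x⁻¹ = t * a⁻¹ := by
      have h1 : res (x * a * x⁻¹ * a) = 1 := by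
        simp only [map_mul, map_inv, hx, ha]
        rw [hx'a]; group
      rcases (hmemN _).1 ((hker _).1 h1) with h2 | h2
      · exact Or.inl (mul_eq_one_iff_eq_inv.1 h2)
      · right
        rw [← h2, mul_inv_cancel_right]
    -- `a y = y a`: otherwise the dicyclic-lift lemma gives an involution of `Gal/⟨tc⟩` not commuting with `a`, against STRUCT
    have hay : a * y = y * a := by
      rcases hconj a with hya | hya
      · exact mul_inv_eq_iff_eq_mul.1 hya
      exfalso
      obtain ⟨w, hww, hw1, hw2⟩ := exists_sq_eq_and_ne_of_dicyclic_lift ht htt hcc hccen htcen ha4 hya hxx hxa (hconj x)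
      have htc1 : t * c ≠ 1 := fun h => htc (by
        rw [mul_eq_one_iff_eq_inv] at h
        rw [h]
        exact inv_eq_of_mul_eq_one_right hcc)
      have htccen : ∀ g : K ≃ₐ[ℚ] K, g * (t * c) = t * c * g := fun g => by
        rw [← mul_assoc, htcen g, mul_assoc, hccen g, ← mul_assoc]
      set N₂ := Subgroup.zpowers (t * c) with hN₂
      have hmemN₂ : ∀ σ : K ≃ₐ[ℚ] K, σ ∈ N₂ ↔ σ = 1 ∨ σ = t * c := fun σ => by
        rw [hN₂]; exact mem_zpowers_iff_of_mul_self_eq_one htcsq σ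
      haveI : N₂.Normal := normal_zpowers_of_forall_comm htccen
      have hcN₂ : c ∉ N₂ := fun h => by
        rcases (hmemN₂ c).1 h with h | h
        · exact hc1 h
        · exact ht1 (mul_right_cancel (a := 1) (by rw [one_mul]; exact h)).symm
      have hN₂bot : N₂ ≠ ⊥ := fun h => htc1 (by
        have := (hmemN₂ (t * c)).2 (Or.inr rfl)
        rw [h] at this
        exact Subgroup.mem_bot.1 this)
      have hN₂idx : N₂.index = 2 ^ (m + 2) := by
        have h1 := index_zpowers_mul_two htcsq htc1
        rw [hcard, show 2 ^ (m + 3) = 2 ^ (m + 2) * 2 by rw [pow_succ]] at h1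
        exact Nat.eq_of_mul_eq_mul_right (by norm_num) h1
      have h := mul_comm_mod_of_struct N₂ hcN₂ hN₂bot hgood
        (fun (K' : Type) (i₁ : Field K') (i₂ : NumberField K') (i₃ : IsCMField K') (i₄ : IsGalois ℚ K')
          (hd : Module.finrank ℚ K' = N₂.index) => hS K' (hd.trans hN₂idx)) w a ((hmemN₂ _).2 (Or.inr hww))
      rcases (hmemN₂ _).1 h with h' | h'
      · exact hw1 h'
      · exact hw2 h'
    /- `⟨a⟩ × ⟨y⟩ ≅ C_{2^m} × C₄` of index two containing `c ≠ y²` -/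
    have hidx : (Subgroup.closure ({a, y} : Set (K ≃ₐ[ℚ] K))).index = 2 :=
      index_closure_pair_eq_two hay hint (by rw [hcard, hoa, hoy]; ring)
    have hcA : c ∈ Subgroup.closure ({a, y} : Set (K ≃ₐ[ℚ] K)) := by
      have haA : a ∈ Subgroup.closure ({a, y} : Set (K ≃ₐ[ℚ] K)) := Subgroup.subset_closure (by simp)
      have hyA : y ∈ Subgroup.closure ({a, y} : Set (K ≃ₐ[ℚ] K)) := Subgroup.subset_closure (by simp)
      have htA : t ∈ Subgroup.closure ({a, y} : Set (K ≃ₐ[ℚ] K)) := by rw [ht]; exact Subgroup.mul_mem _ hyA hyA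
      have hαA : a ^ 2 ^ (k - 2) ∈ Subgroup.closure ({a, y} : Set (K ≃ₐ[ℚ] K)) := Subgroup.pow_mem _ haA _
      rcases hα with h | h
      · rw [h]; exact hαA
      · rw [h]; exact Subgroup.mul_mem _ htA hαA
    have := complexConj_eq_sq_of_cyclic_times_four_index_two hgood a y hay (by omega : 3 ≤ m) hoa hy4 hy2 hint hidx hcA
    exact hyc this.symm

end Field

end Summit.HodgeConjecture.CorCM.GaloisModels
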